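import Mathlib
import HarnessLib
import Literature.Analysis.FluidPDE.SuitableWeak
import Literature.Analysis.FluidPDE.SelfSimilar
import Literature.Analysis.FluidPDE.LocalTypeI
import Literature.Analysis.FluidPDE.ESSLocalHolderNoConcentration
import Summits.NavierStokesRegularity.NavierStokesRegularity.Theorems.RellichScarNoMildScar

/-!
# The far-field representative on a cone (line calm-cone-carleman, crux ApexLocalisation stmt-NavierStokesRegularity-11719, stub `stub_coneFarFieldRepresentative`)

Step S3c of the cone Liouville theorem of the line `calm-cone-carleman` (the cone widening of the
half-space step S3 `stub_halfspaceFarFieldRepresentative`): the inputs of the far-field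
backward-uniqueness step S2c.  Setting: `(w, π)` is a suitable weak solution of the Navier–Stokes
system on the backward slab `]-∞, 0[ × ℝ³` with a weak spatial gradient `H` and `𝐈 < ∞`,
`|w| ≤ 1` a.e. on `]-2, 0[ × F` where `F = {x | κ‖x‖ < ⟪x, e⟫, R₀ < ⟪x, e⟫}` is the far cone
(`‖e‖ = 1`, `0 ≤ κ < 1`), and `w` is uniformly small near the top time there.  Conclusion: on
`Ω = ]-1, 0[ × S`, `S = s e + Γ_κ(e) = {x | κ‖x - s e‖ < ⟪x - s e, e⟫}` the translated cone
(`R₀ + 1 ≤ s`, `1 + κ ≤ s (1 - κ)`), the field `w` has a jointly continuous representative `Uf`,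
`C⁴` in space with jointly continuous spatial derivatives `D_xⁿUf` (`n ≤ 4`) and `‖D_xⁿUf‖ ≤ K`
(`n ≤ 3`), solving the Navier–Stokes system on `Ω` in the sense of distributions with the
ORIGINAL pressure `π`; moreover the cut-off field `w·1_F` equals `Uf` a.e. on `Ω` and its slices
vanish weakly at the top time.

Proof: the template `stub_halfspaceFarFieldRepresentative` (itself the tree's
`RellichScarNoMildScar.apex_farField_representative`; Escauriaza–Seregin–Šverák 2003, §3,
(3.26)–(3.30); Lemarié-Rieusset 2016, proof of Thm. 15.4, Step 2) with the half-space replaced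
by the cone.  The only new ingredient is the thickening lemma `coneFarField_ball_subset`: every
unit ball about a point of `s e + Γ_κ(e)` lies in `F`.  Around every point of `Ω` the cylinder
`Q((t + 1/4) ∧ 0, x; 1)` then lies in `]-2, 0[ × F`, where `|w| ≤ 1`, and in the per-cylinder
pressure gauge `π − [π]_{B(x, 1)}` (`sub_ballMean_slab`) the `L^{3/2}` norm of the pressure is at
most `𝐈` (`lintegral_sub_ballMean_le_typeIBound`); Serrin's interior regularity theory for bounded
solutions with the uniform derivative bounds (`NSBoundedHigherRegularityBounds_holds`) glued over
`Ω` (`exists_smooth_representative_of_locally_bounded_gauge`) gives the representative.  The weak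
vanishing of the cut-off field at the top is immediate from the uniform smallness (Fubini and
`|∫ ⟪w 1_F(s), φ⟫| ≤ ε' ‖φ‖₁`).

* `stub_coneFarFieldRepresentative` — the statement S3c.

References: L. Escauriaza, G. Seregin, V. Šverák, *`L_{3,∞}`-solutions of Navier–Stokes equations
and backward uniqueness*, Russ. Math. Surveys 58 (2003) 211–250, §3 (3.26)–(3.30)
[EscauriazaSereginSverak2003]; P. G. Lemarié-Rieusset, *The Navier–Stokes problem in the 21st
century*, CRC Press 2016, proof of Thm. 15.4, Step 2 [LemarieRieusset2016].
-/

noncomputable section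

set_option linter.dupNamespace false

namespace Summit.NavierStokesRegularity.NavierStokesRegularity.Theorems.RellichScarApexLocalisation

open MeasureTheory Set Function Metric Filter Topology TopologicalSpace
open scoped ENNReal NNReal InnerProductSpace RealInnerProductSpace
open Literature.Analysis Literature.Analysis.FluidPDE
open Summit.NavierStokesRegularity.NavierStokesRegularity.Theorems.RellichScarNoMildScar

local notation "E³" => EuclideanSpace ℝ (Fin 3)

/-- The open backward slab `(-∞, 0) × ℝ³` (time first). -/
local notation "𝕊" => Literature.Analysis.FluidPDE.slab (EuclideanSpace ℝ (Fin 3)) (Set.Iio (0 : ℝ)) isOpen_Iio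

/-! ### Geometry of the far cone -/

/-- **The unit thickening of the translated cone `s e + Γ_κ(e)` lies in the far cone
`F = {κ‖y‖ < ⟪y, e⟫, R₀ < ⟪y, e⟫}`** (`‖e‖ = 1`, `0 ≤ κ`, `0 < R₀`, `R₀ + 1 ≤ s`,
`1 + κ ≤ s (1 - κ)`).  Write `x = s e + γ` with `κ‖γ‖ < ⟪γ, e⟫`; then `⟪x, e⟫ = s + ⟪γ, e⟫` and
`‖x‖ ≤ s + ‖γ‖`.  For `‖y - x‖ < 1`: `⟪y, e⟫ > s + ⟪γ, e⟫ - 1 ≥ s - 1 ≥ R₀` (Cauchy–Schwarz), and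
`κ‖y‖ ≤ κ s + κ‖γ‖ + κ < κ s + ⟪γ, e⟫ + κ ≤ ⟪y, e⟫ + 1 + κ - s (1 - κ) ≤ ⟪y, e⟫`. [folklore] -/
private theorem coneFarField_ball_subset {κ : ℝ} (hκ0 : 0 ≤ κ) {e : E³} (he : ‖e‖ = 1) {R₀ s : ℝ}
    (hR₀ : 0 < R₀) (hs1 : R₀ + 1 ≤ s) (hs3 : 1 + κ ≤ s * (1 - κ)) {x : E³}
    (hx : κ * ‖x - s • e‖ < ⟪x - s • e, e⟫) :
    ball x (2 * (1 / 2 : ℝ)) ⊆ {y : E³ | κ * ‖y‖ < ⟪y, e⟫ ∧ R₀ < ⟪y, e⟫} := by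
  intro y hy
  rw [mem_ball, dist_eq_norm] at hy
  set γ : E³ := x - s • e with hγ
  have hxγ : x = s • e + γ := by rw [hγ]; abel
  have hs0 : 0 ≤ s := by linarith
  have hse : ‖s • e‖ = s := by rw [norm_smul, he, mul_one, Real.norm_of_nonneg hs0]
  -- `⟪x, e⟫ = s + ⟪γ, e⟫` and `‖x‖ ≤ s + ‖γ‖`
  have hxe : ⟪x, e⟫ = s + ⟪γ, e⟫ := by
    rw [hxγ, inner_add_left, real_inner_smul_left, real_inner_self_eq_norm_sq, he]
    ring
  have hxn : ‖x‖ ≤ s + ‖γ‖ := by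
    calc ‖x‖ = ‖s • e + γ‖ := by rw [← hxγ]
      _ ≤ ‖s • e‖ + ‖γ‖ := norm_add_le _ _
      _ = s + ‖γ‖ := by rw [hse]
  -- Cauchy–Schwarz for `y - x`
  have h1 : |⟪y - x, e⟫| ≤ ‖y - x‖ * ‖e‖ := abs_real_inner_le_norm (y - x) e
  rw [he, mul_one, inner_sub_left, abs_le] at h1
  have hye : s + ⟪γ, e⟫ - 1 < ⟪y, e⟫ := by linarith [h1.1]
  have hκγ : 0 ≤ κ * ‖γ‖ := mul_nonneg hκ0 (norm_nonneg _)
  have hyn : ‖y‖ ≤ s + ‖γ‖ + 1 := by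
    calc ‖y‖ = ‖(y - x) + x‖ := by rw [sub_add_cancel]
      _ ≤ ‖y - x‖ + ‖x‖ := norm_add_le _ _
      _ ≤ s + ‖γ‖ + 1 := by linarith
  have hκy : κ * ‖y‖ ≤ κ * (s + ‖γ‖ + 1) := mul_le_mul_of_nonneg_left hyn hκ0
  refine ⟨?_, ?_⟩
  · show κ * ‖y‖ < ⟪y, e⟫
    nlinarith
  · show R₀ < ⟪y, e⟫
    linarith

/-- **The far cone `F = {κ‖x‖ < ⟪x, e⟫, R₀ < ⟪x, e⟫}` is open.** [folklore] -/
private theorem coneFarField_isOpen (κ : ℝ) (e : E³) (R₀ : ℝ) :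
    IsOpen {x : E³ | κ * ‖x‖ < ⟪x, e⟫ ∧ R₀ < ⟪x, e⟫} := by
  have h1 : IsOpen {x : E³ | κ * ‖x‖ < ⟪x, e⟫} :=
    isOpen_lt (continuous_const.mul continuous_norm) (continuous_id.inner continuous_const)
  have h2 : IsOpen {x : E³ | R₀ < ⟪x, e⟫} :=
    isOpen_lt continuous_const (continuous_id.inner continuous_const)
  exact h1.inter h2

/-! ### Weak vanishing of the cut-off field at the top time -/

/-- **Uniform smallness near the top implies weak vanishing of the cut-off slices.**  If for
every `ε > 0` there is `s₀ < 0` with `|w| ≤ ε` a.e. on `]s₀, 0[ × F`, `F` the far cone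
`{κ‖x‖ < ⟪x, e⟫, R₀ < ⟪x, e⟫}`, then for every continuous compactly supported `φ` and `ε > 0`
there is `s₀ < 0` with `|∫ ⟪w 1_F(s), φ⟫| ≤ ε` for a.e. `s ∈ ]s₀, 0[`: by Fubini, for a.e. such
`s` the slice bound holds a.e. in space, and `|∫ ⟪w 1_F(s), φ⟫| ≤ ε' ‖φ‖₁` with
`ε' = ε / (‖φ‖₁ + 1)`. [folklore] -/
private theorem coneFarField_weakTop {w : ℝ → E³ → E³} {κ : ℝ} {e : E³} {R₀ : ℝ}
    (hsmall : ∀ ε : ℝ, 0 < ε → ∃ s₀ : ℝ, s₀ < 0 ∧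
      ∀ᵐ z ∂(volume.restrict (Ioo s₀ 0 ×ˢ {x : E³ | κ * ‖x‖ < ⟪x, e⟫ ∧ R₀ < ⟪x, e⟫})),
        ‖w z.1 z.2‖ ≤ ε)
    (φ : E³ → E³) (hφ : Continuous φ) (hφc : HasCompactSupport φ) {ε : ℝ} (hε : 0 < ε) :
    ∃ s₀ : ℝ, s₀ < 0 ∧ ∀ᵐ s ∂(volume.restrict (Ioo s₀ 0)),
      |∫ y, ⟪(if κ * ‖y‖ < ⟪y, e⟫ ∧ R₀ < ⟪y, e⟫ then w s y else 0), φ y⟫| ≤ ε := by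
  have hφi : Integrable φ := hφ.integrable_of_hasCompactSupport hφc
  set M : ℝ := ∫ y, ‖φ y‖ with hM
  have hM0 : 0 ≤ M := integral_nonneg fun _ => norm_nonneg _
  have hε' : 0 < ε / (M + 1) := div_pos hε (by linarith)
  obtain ⟨s₀, hs₀, hsm⟩ := hsmall (ε / (M + 1)) hε'
  refine ⟨s₀, hs₀, ?_⟩
  have hB : MeasurableSet {x : E³ | κ * ‖x‖ < ⟪x, e⟫ ∧ R₀ < ⟪x, e⟫} :=
    (coneFarField_isOpen κ e R₀).measurableSet
  have h1 : ∀ᵐ z ∂((volume.restrict (Ioo s₀ 0)).prod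
      (volume.restrict {x : E³ | κ * ‖x‖ < ⟪x, e⟫ ∧ R₀ < ⟪x, e⟫})), ‖w z.1 z.2‖ ≤ ε / (M + 1) := by
    rw [Measure.prod_restrict, ← Measure.volume_eq_prod]
    exact hsm
  filter_upwards [Measure.ae_ae_of_ae_prod h1] with s hs
  have hs' : ∀ᵐ y, y ∈ {x : E³ | κ * ‖x‖ < ⟪x, e⟫ ∧ R₀ < ⟪x, e⟫} → ‖w s y‖ ≤ ε / (M + 1) :=
    (ae_restrict_iff' hB).1 hs
  have hpt : ∀ᵐ y, ‖⟪(if κ * ‖y‖ < ⟪y, e⟫ ∧ R₀ < ⟪y, e⟫ then w s y else 0), φ y⟫‖ ≤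
      ε / (M + 1) * ‖φ y‖ := by
    filter_upwards [hs'] with y hy
    by_cases hyB : κ * ‖y‖ < ⟪y, e⟫ ∧ R₀ < ⟪y, e⟫
    · rw [if_pos hyB]
      exact (norm_inner_le_norm _ _).trans (mul_le_mul_of_nonneg_right (hy hyB) (norm_nonneg _))
    · rw [if_neg hyB, inner_zero_left, norm_zero]
      positivity
  have hint : ∫ y, ε / (M + 1) * ‖φ y‖ = ε / (M + 1) * M := by
    rw [integral_const_mul]
  calc |∫ y, ⟪(if κ * ‖y‖ < ⟪y, e⟫ ∧ R₀ < ⟪y, e⟫ then w s y else 0), φ y⟫|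
      = ‖∫ y, ⟪(if κ * ‖y‖ < ⟪y, e⟫ ∧ R₀ < ⟪y, e⟫ then w s y else 0), φ y⟫‖ :=
        (Real.norm_eq_abs _).symm
    _ ≤ ∫ y, ε / (M + 1) * ‖φ y‖ := norm_integral_le_of_norm_le (hφi.norm.const_mul _) hpt
    _ = ε / (M + 1) * M := hint
    _ ≤ ε := by
        rw [div_mul_eq_mul_div, div_le_iff₀ (by linarith)]
        nlinarith [hε.le, hM0]

/-! ### S3c — the far-field representative on a cone -/

/-- **S3c: the far-field representative on a cone** (Escauriaza–Seregin–Šverák 2003, §3,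
(3.26)–(3.30); Lemarié-Rieusset 2016, proof of Thm. 15.4, Step 2; the half-space step
`stub_halfspaceFarFieldRepresentative` with the far half-space replaced by the far cone
`F = {κ‖x‖ < ⟪x, e⟫, R₀ < ⟪x, e⟫}` and the representative living on the translated cone
`s e + Γ_κ(e)`, `R₀ + 1 ≤ s`, `1 + κ ≤ s (1 - κ)`).  If `(w, π)` is a suitable weak slab solution
with weak gradient `H`, `𝐈 < ⊤`, `|w| ≤ 1` a.e. on `]-2, 0[ × F` and `w` is uniformly small near
the top there (`∀ ε, ∃ s₀ < 0, |w| ≤ ε` a.e. on `]s₀, 0[ × F`), then on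
`Ω = ]-1, 0[ × (s e + Γ_κ(e))` the field `w` has a jointly continuous representative `Uf`, smooth
in space with jointly continuous spatial derivatives and `‖D_xⁿUf‖ ≤ K` (`n ≤ 3`), solving
Navier–Stokes on `Ω` with the pressure `π` (Serrin's theory through
`exists_smooth_representative_of_locally_bounded_gauge` in the per-cylinder pressure gauge; every
unit ball about a point of `s e + Γ_κ(e)` lies in `F`, `coneFarField_ball_subset`), and the
cut-off field `w·1_F` (equal to `Uf` a.e. on `Ω`) has slices vanishing weakly at the top.
[cite: EscauriazaSereginSverak2003, §3 (3.26)-(3.30)] [cite: LemarieRieusset2016, proof of Thm. 15.4, Step 2] -/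
theorem stub_coneFarFieldRepresentative :
    ∀ (κ : ℝ), 0 ≤ κ → κ < 1 → ∀ (e : E³), ‖e‖ = 1 → ∀ (R₀ s : ℝ), 0 < R₀ → R₀ + 1 ≤ s → 1 + κ ≤ s * (1 - κ) →
      ∀ (w : ℝ → E³ → E³) (π : ℝ → E³ → ℝ) (H : ℝ → E³ → E³ →L[ℝ] E³),
      IsSuitableWeakSolutionOn 𝕊 1 0 w π → HasWeakSpatialGradientOn 𝕊 w H →
      typeIBound (Iio (0 : ℝ) ×ˢ univ) w π H < ⊤ →
      (∀ᵐ z ∂(volume.restrict (Ioo (-2 : ℝ) 0 ×ˢ {x : E³ | κ * ‖x‖ < ⟪x, e⟫ ∧ R₀ < ⟪x, e⟫})), ‖w z.1 z.2‖ ≤ 1) →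
      (∀ ε : ℝ, 0 < ε → ∃ s₀ : ℝ, s₀ < 0 ∧
        ∀ᵐ z ∂(volume.restrict (Ioo s₀ 0 ×ˢ {x : E³ | κ * ‖x‖ < ⟪x, e⟫ ∧ R₀ < ⟪x, e⟫})), ‖w z.1 z.2‖ ≤ ε) →
      ∃ (Uf : ℝ → E³ → E³) (K : ℝ),
        uncurry Uf =ᵐ[volume.restrict (Ioo (-1 : ℝ) 0 ×ˢ {x : E³ | κ * ‖x - s • e‖ < ⟪x - s • e, e⟫})] uncurry w ∧
        ContinuousOn (uncurry Uf) (Ioo (-1 : ℝ) 0 ×ˢ {x : E³ | κ * ‖x - s • e‖ < ⟪x - s • e, e⟫}) ∧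
        (∀ φ : E³ → E³, ContDiff ℝ (⊤ : ℕ∞) φ → HasCompactSupport φ → ∀ ε : ℝ, 0 < ε →
          ∃ s₀ : ℝ, s₀ < 0 ∧ ∀ᵐ t ∂(volume.restrict (Ioo s₀ 0)),
            |∫ y, ⟪(if κ * ‖y‖ < ⟪y, e⟫ ∧ R₀ < ⟪y, e⟫ then w t y else 0), φ y⟫| ≤ ε) ∧
        (uncurry Uf =ᵐ[volume.restrict (Ioo (-1 : ℝ) 0 ×ˢ {x : E³ | κ * ‖x - s • e‖ < ⟪x - s • e, e⟫})]
          fun z => if κ * ‖z.2‖ < ⟪z.2, e⟫ ∧ R₀ < ⟪z.2, e⟫ then w z.1 z.2 else 0) ∧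
        IsDistributionalNSSolutionOn ⟨Ioo (-1 : ℝ) 0 ×ˢ {x : E³ | κ * ‖x - s • e‖ < ⟪x - s • e, e⟫},
          isOpen_Ioo.prod (isOpen_lt (continuous_const.mul (continuous_id.sub continuous_const).norm)
            ((continuous_id.sub continuous_const).inner continuous_const))⟩ 1 0 Uf π ∧
        (∀ t ∈ Ioo (-1 : ℝ) 0, ContDiffOn ℝ 4 (Uf t) {x : E³ | κ * ‖x - s • e‖ < ⟪x - s • e, e⟫}) ∧
        (∀ n ≤ 4, ContinuousOn (fun z : ℝ × E³ => iteratedFDeriv ℝ n (Uf z.1) z.2)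
          (Ioo (-1 : ℝ) 0 ×ˢ {x : E³ | κ * ‖x - s • e‖ < ⟪x - s • e, e⟫})) ∧
        (∀ n ≤ 3, ∀ z ∈ Ioo (-1 : ℝ) 0 ×ˢ {x : E³ | κ * ‖x - s • e‖ < ⟪x - s • e, e⟫},
          ‖iteratedFDeriv ℝ n (Uf z.1) z.2‖ ≤ K) := by
  intro κ hκ0 _hκ1 e he R₀ s hR₀ hs1 hs3 w π H hsw _hwg hI hfar hsmall
  set I : ℝ≥0∞ := typeIBound (Iio (0 : ℝ) ×ˢ (univ : Set E³)) w π H with hIdef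
  have hItop : I ≠ ⊤ := hI.ne
  set S : Set E³ := {x : E³ | κ * ‖x - s • e‖ < ⟪x - s • e, e⟫} with hS
  have hSo : IsOpen S :=
    isOpen_lt (continuous_const.mul (continuous_id.sub continuous_const).norm)
      ((continuous_id.sub continuous_const).inner continuous_const)
  -- the thickening condition: unit balls about `S` lie in the far cone `F`
  have hSS' : ∀ x ∈ S, ball x (2 * (1 / 2 : ℝ)) ⊆ {y : E³ | κ * ‖y‖ < ⟪y, e⟫ ∧ R₀ < ⟪y, e⟫} :=
    fun x hx => coneFarField_ball_subset hκ0 he hR₀ hs1 hs3 hx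
  -- ## the representative, cylinder by cylinder in the local gauge
  set P : ℝ≥0 := (ENNReal.ofReal (2 * (1 / 2 : ℝ)) ^ 2 * I).toNNReal with hP
  have hPeq : ((P : ℝ≥0) : ℝ≥0∞) = ENNReal.ofReal (2 * (1 / 2 : ℝ)) ^ 2 * I :=
    ENNReal.coe_toNNReal (ENNReal.mul_ne_top (ENNReal.pow_ne_top ENNReal.ofReal_ne_top) hItop)
  have hloc : ∀ z ∈ Ioo (-1 : ℝ) 0 ×ˢ S, ∃ πz : ℝ → E³ → ℝ,
      IsDistributionalNSSolutionOn
        (parabolicCylinderOpens (2 * (1 / 2 : ℝ)) (min (z.1 + (1 / 2 : ℝ) ^ 2) 0, z.2)) 1 0 w πz ∧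
      (∀ᵐ q ∂(volume.restrict (parabolicCylinder (2 * (1 / 2 : ℝ)) (min (z.1 + (1 / 2 : ℝ) ^ 2) 0, z.2))),
        ‖w q.1 q.2‖ ≤ (1 : ℝ)) ∧
      ∫⁻ q in parabolicCylinder (2 * (1 / 2 : ℝ)) (min (z.1 + (1 / 2 : ℝ) ^ 2) 0, z.2),
        ‖πz q.1 q.2‖ₑ ^ (3 / 2 : ℝ) ≤ P := by
    rintro ⟨t, x⟩ ⟨ht, hx⟩
    set z₀ : ℝ × E³ := (min (t + (1 / 2 : ℝ) ^ 2) 0, x) with hz₀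
    have hz₀t : z₀.1 ≤ 0 := min_le_right _ _
    refine ⟨fun s' y => π s' y - ⨍ y' in ball z₀.2 (2 * (1 / 2 : ℝ)), π s' y', ?_, ?_, ?_⟩
    · exact ((sub_ballMean_slab hsw z₀.2 (by norm_num : (0 : ℝ) < 2 * (1 / 2))).of_le
        (parabolicCylinderOpens_le_slab _ hz₀t)).distributional
    · -- the cylinder lies in the far cone
      have hcyl : parabolicCylinder (2 * (1 / 2 : ℝ)) z₀ ⊆
          Ioo (-2 : ℝ) 0 ×ˢ {y : E³ | κ * ‖y‖ < ⟪y, e⟫ ∧ R₀ < ⟪y, e⟫} := by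
        rintro ⟨s', y⟩ hq
        rw [mem_parabolicCylinder] at hq
        obtain ⟨⟨hs1', hs2'⟩, hy⟩ := hq
        refine ⟨⟨?_, lt_of_lt_of_le hs2' hz₀t⟩, hSS' x hx (mem_ball.2 hy)⟩
        have h1 : -1 < min (t + (1 / 2 : ℝ) ^ 2) 0 := lt_min (by linarith [ht.1]) (by norm_num)
        have h2 : z₀.1 = min (t + (1 / 2 : ℝ) ^ 2) 0 := rfl
        rw [h2] at hs1'
        nlinarith
      exact ae_restrict_of_ae_restrict_of_subset hcyl hfar
    · rw [hPeq]
      exact lintegral_sub_ballMean_le_typeIBound (by norm_num) hz₀t w π H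
  obtain ⟨K, U, hUw, hUc, hCD, hjc, hbdK⟩ := exists_smooth_representative_of_locally_bounded_gauge
    NSBoundedHigherRegularityBounds_holds hSo (by norm_num : (0 : ℝ) < 1 / 2) hloc 4
  -- ## the equations on the translated cone and the regularity of the representative
  set Ω : Set (ℝ × E³) := Ioo (-1 : ℝ) 0 ×ˢ S with hΩ
  have hΩo : IsOpen Ω := isOpen_Ioo.prod hSo
  have hΩle : (⟨Ω, hΩo⟩ : Opens (ℝ × E³)) ≤ (slab E³ (Iio (0 : ℝ)) isOpen_Iio) := by
    intro z hz
    rw [mem_slab]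
    exact hz.1.2
  have hsolw : IsDistributionalNSSolutionOn ⟨Ω, hΩo⟩ 1 0 w π := (hsw.of_le hΩle).distributional
  have hsol : IsDistributionalNSSolutionOn ⟨Ω, hΩo⟩ 1 0 U π :=
    hsolw.congr_ae hUw.symm (ae_of_all _ fun _ => rfl)
  have hU4 : ∀ t ∈ Ioo (-1 : ℝ) 0, ContDiffOn ℝ 4 (U t) S := fun t ht x hx =>
    ((hCD (t, x) ⟨ht, hx⟩).of_le (by norm_cast)).contDiffWithinAt
  have hΦ : ∀ n ≤ 4, ContinuousOn (fun z : ℝ × E³ => iteratedFDeriv ℝ n (U z.1) z.2) Ω :=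
    fun n _ => hjc n
  have hK : ∀ n ≤ 3, ∀ z ∈ Ω, ‖iteratedFDeriv ℝ n (U z.1) z.2‖ ≤ K := fun n hn z hz =>
    hbdK n (by omega) z hz
  -- ## the cut-off field agrees with `w`, hence with `U`, on the translated cone
  have hcut : uncurry U =ᵐ[volume.restrict Ω]
      fun z => if κ * ‖z.2‖ < ⟪z.2, e⟫ ∧ R₀ < ⟪z.2, e⟫ then w z.1 z.2 else 0 := by
    refine hUw.trans ?_
    filter_upwards [ae_restrict_mem (measurableSet_Ioo.prod hSo.measurableSet)] with z hz
    have hz2 : κ * ‖z.2‖ < ⟪z.2, e⟫ ∧ R₀ < ⟪z.2, e⟫ :=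
      hSS' z.2 hz.2 (mem_ball_self (by norm_num))
    show w z.1 z.2 = if κ * ‖z.2‖ < ⟪z.2, e⟫ ∧ R₀ < ⟪z.2, e⟫ then w z.1 z.2 else 0
    rw [if_pos hz2]
  exact ⟨U, K, hUw, hUc,
    fun φ hφ hφc ε hε => coneFarField_weakTop hsmall φ hφ.continuous hφc hε,
    hcut, hsol, hU4, hΦ, hK⟩

end Summit.NavierStokesRegularity.NavierStokesRegularity.Theorems.RellichScarApexLocalisation

end
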